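import Summits.ResolutionOfSingularities.ResolutionOfSingularities.Theorems.ValuativeLuAlphaPTorsorFreeChart
import Summits.ResolutionOfSingularities.ResolutionOfSingularities.Theorems.ValuativeLuAlphaPTorsorFreeColength
import Summits.ResolutionOfSingularities.ResolutionOfSingularities.Theorems.ValuativeLuAlphaPTorsorGiraudIII

/-!
# Giraud's free step with free successor: the colength of the finite part drops strictly

Helper file for the stub `giraud_free_step_free` (FS-F: Giraud 1983, Lemme 2.3 (ii)+(iii) in
valuation language) of the line `pfaff-line-log-final-forms` (crux `Valuative.LuAlphaPTorsor`,
item `stmt-ResolutionOfSingularities-0641`).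

Setting: `R ⊆ K` a two-dimensional regular local ring dominated by the valuation ring `O`, `R₁`
its quadratic transform along `O`, `x = u i₀` a regular parameter of MINIMAL value (so
`R₁ = (R[y/x])_Q`, `Q` the centre of `O` on the chart `A = R[y/x]`), boundary `{x}`, and
`C_{x}(f) = (xᵃ) · D₀` the log-content of `f` with finite part `D₀ ≠ R` of finite colength.

* the second parameter `y` is ADAPTED to `Q`: either `y/x ∈ Q`, or no translate `y/x - γ`
  (`γ ∈ R`) lies in `Q` (`Q` is a non-rational point of the exceptional line, or its generic
  point);
* `exists_finitePart_freeStep` — with `Dy` the dual derivation of `y`, `Dy f = xᵃ B` and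
  `C_{x,y}(f) = (xᵃ) · D₁` where `y D₀ ⊆ D₁ ⊆ D₀ = D₁ + (B)` (`C_{x} = C_{x,y} + (Dy f)`,
  `y · C_{x} ⊆ C_{x,y}`);
* `content_free_chart` (F1): `C_{x}(f; R₁) = C_{x,y}(f) R₁ + x C_{x}(f) R₁ = (xᵃ) · 𝔟 R₁` with
  `𝔟 = D₁ + x D₀`, and `free_chart_colength` (F2x): `𝔟 R₁ = (xʳ) · H'`, `λ(R₁/H') ≤ λ(R/D₀)`,
  strictly unless every order-one `φ ∈ D₁` has its strict transform in `Q`;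
* `not_bad_freeStep` — that exception does not occur: for an order-one `φ = αx + βy ∈ D₁`,
  `xᵃ φ = Δ f` with `Δ` logarithmic along `x` and `y` (`exists_derivation_of_mem_span_freeStep`),
  so `α` is a unit by Giraud's commutator argument (`mem_maximalIdeal_of_sub_mul_mem_sq`, V2),
  and then the strict transform of `φ` avoids the adapted `Q`
  (`strictTransform_not_mem_of_order_one`, V5b).

References: J. Giraud, *Forme normale d'une fonction sur une surface de caractéristique
positive*, Bull. SMF 111 (1983), Lemme 2.3, §2.5.
-/

set_option linter.dupNamespace false

noncomputable section

open IsLocalRing Literature.AlgebraicGeometry.Resolution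

namespace Summit.ResolutionOfSingularities.ResolutionOfSingularities.Theorems.PfaffLine

section Abstract

variable {S : Type*} [CommRing S]

/-- **Every element of a content ideal is a single value `δ f`.** If the class `P` of derivations
contains `0` and is stable under sums and multiples, then `{δ f | P δ}` is (the carrier of) a
submodule, so it equals its span. [folklore] -/
theorem exists_derivation_of_mem_span_freeStep (P : Derivation ℤ S S → Prop) (h0 : P 0)
    (hadd : ∀ δ ε, P δ → P ε → P (δ + ε)) (hsmul : ∀ (c : S) (δ), P δ → P (c • δ)) (f : S)
    {z : S} (hz : z ∈ Ideal.span {b | ∃ δ : Derivation ℤ S S, P δ ∧ δ f = b}) :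
    ∃ δ : Derivation ℤ S S, P δ ∧ δ f = z := by
  induction hz using Submodule.span_induction with
  | mem _ h => exact h
  | zero => exact ⟨0, h0, rfl⟩
  | add _ _ _ _ ha hb =>
    obtain ⟨δ, hδ, rfl⟩ := ha
    obtain ⟨ε, hε, rfl⟩ := hb
    exact ⟨δ + ε, hadd δ ε hδ hε, rfl⟩
  | smul c _ _ ha =>
    obtain ⟨δ, hδ, rfl⟩ := ha
    exact ⟨c • δ, hsmul c δ hδ, rfl⟩

/-- **The finite parts for the boundaries `{x}` and `{x, y}`.** In a domain, let `Dy x = 0`,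
`Dy y = 1` and `C_{x}(f) = (xᵃ) · D₀`. Then `C_{x,y}(f) = (xᵃ) · D₁` with
`y D₀ ⊆ D₁ ⊆ D₀ = D₁ + (B)`, where `Dy f = xᵃ B`: indeed `C_{x,y} ⊆ C_{x} ⊆ (xᵃ)`,
`y · C_{x} ⊆ C_{x,y}` (`y δ` is logarithmic along `y`) and `C_{x} = C_{x,y} + (Dy f)`
(`δ = (δ - (δ y) Dy) + (δ y) Dy`); then cancel `xᵃ`. [folklore] -/
theorem exists_finitePart_freeStep [IsDomain S] {x y : S} (hx0 : x ≠ 0) (Dy : Derivation ℤ S S)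
    (hDyx : Dy x = 0) (hDyy : Dy y = 1) (f : S) (a : ℕ) (D₀ : Ideal S)
    (hC : Ideal.span {b | ∃ δ : Derivation ℤ S S, δ x ∈ Ideal.span {x} ∧ δ f = b} =
      Ideal.span {x ^ a} * D₀) :
    ∃ (D₁ : Ideal S) (B : S), D₁ ≤ D₀ ∧ Ideal.span {y} * D₀ ≤ D₁ ∧ D₀ = D₁ ⊔ Ideal.span {B} ∧
      Ideal.span {b | ∃ δ : Derivation ℤ S S, (δ x ∈ Ideal.span {x} ∧ δ y ∈ Ideal.span {y}) ∧
        δ f = b} = Ideal.span {x ^ a} * D₁ := by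
  set Cx := Ideal.span {b | ∃ δ : Derivation ℤ S S, δ x ∈ Ideal.span {x} ∧ δ f = b} with hCxdef
  set Cxy := Ideal.span {b | ∃ δ : Derivation ℤ S S,
    (δ x ∈ Ideal.span {x} ∧ δ y ∈ Ideal.span {y}) ∧ δ f = b} with hCxydef
  have hxa : x ^ a ≠ 0 := pow_ne_zero a hx0
  have h1 : Cxy ≤ Cx := Ideal.span_mono fun b ⟨δ, hδ, hb⟩ => ⟨δ, hδ.1, hb⟩
  have hCxle : Cx ≤ Ideal.span {x ^ a} := hC ▸ Ideal.mul_le_right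
  have hCxy : Cxy = Ideal.span {x ^ a} * Cxy.colon {x ^ a} :=
    eq_span_singleton_mul_colon (h1.trans hCxle)
  -- `Dy f = xᵃ B`
  have hDyf : Dy f ∈ Cx := Ideal.subset_span ⟨Dy, by rw [hDyx]; exact zero_mem _, rfl⟩
  have hDyf' : Dy f ∈ Ideal.span {x ^ a} * D₀ := hC ▸ hDyf
  obtain ⟨B, -, hB⟩ := Ideal.mem_span_singleton_mul.mp hDyf'
  -- `y · C_{x} ⊆ C_{x,y}`
  have h2 : Ideal.span {y} * Cx ≤ Cxy := by
    rw [hCxdef, Ideal.span_mul_span', Ideal.span_le]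
    rintro _ ⟨c, hc, _, ⟨δ, hδ, rfl⟩, rfl⟩
    rw [Set.mem_singleton_iff] at hc
    subst hc
    refine Ideal.subset_span ⟨c • δ, ⟨?_, ?_⟩, by rw [Derivation.smul_apply, smul_eq_mul]⟩
    · rw [Derivation.smul_apply, smul_eq_mul]
      exact Ideal.mul_mem_left _ _ hδ
    · rw [Derivation.smul_apply, smul_eq_mul]
      exact Ideal.mul_mem_right _ _ (Ideal.mem_span_singleton_self c)
  -- `C_{x} = C_{x,y} + (Dy f)`
  have h3 : Cx = Cxy ⊔ Ideal.span {Dy f} := by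
    refine le_antisymm ?_ (sup_le h1 ((Ideal.span_singleton_le_iff_mem _).mpr hDyf))
    rw [hCxdef, Ideal.span_le]
    rintro _ ⟨δ, hδ, rfl⟩
    have e : δ f = (δ + (-δ y) • Dy) f + δ y * Dy f := by
      rw [Derivation.add_apply, Derivation.smul_apply, smul_eq_mul]; ring
    rw [SetLike.mem_coe, e]
    refine add_mem (Submodule.mem_sup_left (Ideal.subset_span ⟨δ + (-δ y) • Dy, ⟨?_, ?_⟩, rfl⟩))
      (Submodule.mem_sup_right (Ideal.mem_span_singleton'.mpr ⟨δ y, rfl⟩))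
    · rw [Derivation.add_apply, Derivation.smul_apply, hDyx, smul_zero, add_zero]
      exact hδ
    · rw [Derivation.add_apply, Derivation.smul_apply, hDyy, smul_eq_mul, mul_one,
        add_neg_cancel]
      exact zero_mem _
  refine ⟨Cxy.colon {x ^ a}, B, ?_, ?_, ?_, hCxy⟩
  · rw [← Ideal.span_singleton_mul_right_mono hxa, ← hCxy, ← hC]
    exact h1
  · rw [← Ideal.span_singleton_mul_right_mono hxa, ← hCxy, mul_left_comm, ← hC]
    exact h2
  · rw [← Ideal.span_singleton_mul_right_inj hxa, Ideal.mul_sup, ← hCxy,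
      Ideal.span_singleton_mul_span_singleton, hB, ← hC]
    exact h3

end Abstract

section Chart

variable {K : Type} [Field K]

/-- **The exceptional case of F2x does not occur at an adapted point** (Giraud 1983, Lemme 2.3
(ii)+(iii)). With `𝔪 = (x, y)`, `C_{x}(f) = (xᵃ) · D₀ ⊆ (xᵃ) 𝔪`, `C_{x,y}(f) = (xᵃ) · D₁` and
`Q ∋ x` a prime of `R[y/x]` such that `y/x ∈ Q` or no `y/x - γ` lies in `Q`: it is impossible
that `D₁` contains an order-one `φ` all of whose kind have strict transform in `Q`. Indeed
`xᵃ φ = Δ f` for an `{x, y}`-logarithmic `Δ` (`exists_derivation_of_mem_span_freeStep`); writing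
`φ = αx + βy`, if `α ∈ 𝔪` then `φ ≡ βy mod 𝔪²` forces `β ∈ 𝔪` (V2,
`mem_maximalIdeal_of_sub_mul_mem_sq`), contradicting `φ ∉ 𝔪²`; so `α` is a unit and the strict
transform `ψ` of `φ` is not in `Q` (V5b, `strictTransform_not_mem_of_order_one`). [folklore] -/
theorem not_bad_freeStep {R : Subring K} [IsRegularLocalRing R] {x y : R}
    (hdim : ringKrullDim R = 2) (hm : maximalIdeal R = Ideal.span {x, y}) (hx0 : x ≠ 0)
    (Dy : Derivation ℤ R R) (hDyx : Dy x = 0) (hDyy : Dy y = 1) (f : R) (a : ℕ)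
    (D₀ D₁ : Ideal R)
    (hC : Ideal.span {b | ∃ δ : Derivation ℤ R R, δ x ∈ Ideal.span {x} ∧ δ f = b} =
      Ideal.span {x ^ a} * D₀)
    (hCxy : Ideal.span {b | ∃ δ : Derivation ℤ R R,
      (δ x ∈ Ideal.span {x} ∧ δ y ∈ Ideal.span {y}) ∧ δ f = b} = Ideal.span {x ^ a} * D₁)
    (htop : D₀ ≠ ⊤) (h10 : D₁ ≤ D₀) (Q : Ideal (chartAdjoin (K := K) x y)) [Q.IsPrime]
    (hxQ : chartIncl x y x ∈ Q)
    (hadapt : (⟨((y : R) : K) / ((x : R) : K), Algebra.subset_adjoin (Set.mem_singleton _)⟩ :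
        chartAdjoin (K := K) x y) ∈ Q ∨ ∀ γ : R,
      (⟨((y : R) : K) / ((x : R) : K), Algebra.subset_adjoin (Set.mem_singleton _)⟩ :
        chartAdjoin (K := K) x y) - chartIncl x y γ ∉ Q) :
    ¬ ((∃ φ ∈ D₁, φ ∉ maximalIdeal R ^ 2) ∧ ∀ φ ∈ D₁, φ ∉ maximalIdeal R ^ 2 →
      ∀ ψ : chartAdjoin (K := K) x y, chartIncl x y φ = chartIncl x y x * ψ → ψ ∈ Q) := by
  rintro ⟨⟨φ, hφD₁, hφ2⟩, hall⟩
  have hxm : x ∈ maximalIdeal R := hm ▸ Ideal.subset_span (by simp)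
  have hym : y ∈ maximalIdeal R := hm ▸ Ideal.subset_span (by simp)
  -- `xᵃ φ = Δ f` with `Δ` logarithmic along `x` and `y`
  have hmem : x ^ a * φ ∈ Ideal.span {b | ∃ δ : Derivation ℤ R R,
      (δ x ∈ Ideal.span {x} ∧ δ y ∈ Ideal.span {y}) ∧ δ f = b} :=
    hCxy ▸ Ideal.mul_mem_mul (Ideal.mem_span_singleton_self _) hφD₁
  obtain ⟨Δ, ⟨hΔx, hΔy⟩, hΔf⟩ := exists_derivation_of_mem_span_freeStep
    (fun δ : Derivation ℤ R R => δ x ∈ Ideal.span {x} ∧ δ y ∈ Ideal.span {y})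
    ⟨by simp, by simp⟩
    (fun δ ε hδ hε => ⟨by rw [Derivation.add_apply]; exact add_mem hδ.1 hε.1,
      by rw [Derivation.add_apply]; exact add_mem hδ.2 hε.2⟩)
    (fun c δ hδ => ⟨by rw [Derivation.smul_apply, smul_eq_mul]; exact Ideal.mul_mem_left _ _ hδ.1,
      by rw [Derivation.smul_apply, smul_eq_mul]; exact Ideal.mul_mem_left _ _ hδ.2⟩) f hmem
  -- Giraud (iii): the `y`-coefficient of an order-one value is never the only unit
  have h1 : ∀ δ : Derivation ℤ R R, δ x ∈ Ideal.span {x} →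
      δ f ∈ Ideal.span {x ^ a} * maximalIdeal R := fun δ hδ =>
    Ideal.mul_mono_right (le_maximalIdeal htop) (hC.le (Ideal.subset_span ⟨δ, hδ, rfl⟩))
  have hV2 := mem_maximalIdeal_of_sub_mul_mem_sq x y hm.symm hx0 Dy hDyx hDyy f a h1 Δ φ hΔx
    hΔy hΔf
  have hφm : φ ∈ Ideal.span {x, y} := by
    rw [← hm]
    exact le_maximalIdeal htop (h10 hφD₁)
  obtain ⟨α, β, hαβ⟩ := Ideal.mem_span_pair.mp hφm
  have hsq : ∀ c ∈ maximalIdeal R, ∀ d ∈ maximalIdeal R, c * d ∈ maximalIdeal R ^ 2 :=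
    fun c hc d hd => by rw [pow_two]; exact Ideal.mul_mem_mul hc hd
  have hα : IsUnit α := by
    by_contra hα
    have hαm : α ∈ maximalIdeal R := (IsLocalRing.mem_maximalIdeal α).mpr hα
    have hβm : β ∈ maximalIdeal R :=
      hV2 β (by rw [← hαβ, add_sub_cancel_right]; exact hsq α hαm x hxm)
    exact hφ2 (by rw [← hαβ]; exact add_mem (hsq α hαm x hxm) (hsq β hβm y hym))
  -- the strict transform of `φ` avoids `Q`
  obtain ⟨ψ, hψ, hV5⟩ := strictTransform_not_mem_of_order_one hdim hm hx0 φ α β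
    (by rw [← hαβ, sub_self]; exact zero_mem _)
  refine hV5 Q hxQ ?_ (hall φ hφD₁ hφ2 ψ hψ)
  rcases hadapt with ht | hnr
  · exact Or.inl ⟨hα, ht⟩
  · exact Or.inr ⟨Or.inl hα, hnr⟩

/-- **The free step at an adapted point `Q` of the `x`-chart** (Giraud 1983, Lemme 2.3 (ii),
§2.5). For `T = (R[y/x])_Q` the quadratic transform of `R` along `O` (`x` of minimal value,
`y` adapted to `Q`) and `C_{x}(f; R) = (xᵃ) · D₀`: `𝔪_T = (x, w)` and
`C_{x}(f; T) = (xᵃ⁺ʳ) · H'` with `λ(T/H') < λ(R/D₀)`. Assembly of `exists_finitePart_freeStep`,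
`content_free_chart` (F1), `free_chart_colength` (F2x), `not_bad_freeStep` and
`exists_eq_span_pair_of_map_maximalIdeal_le` (`Q = (x, p)`). [folklore] -/
theorem free_step_chart_freeStep (O : ValuationSubring K) (R : Subring K) [IsRegularLocalRing R]
    {x y : R} (hdim : ringKrullDim R = 2) (hm : maximalIdeal R = Ideal.span {x, y})
    (hx0 : x ≠ 0) (Q : Ideal (chartAdjoin (K := K) x y)) [Q.IsPrime]
    (hxQ : chartIncl x y x ∈ Q)
    (h : IsQuadraticTransformAlong O R
      (LocalSubring.ofPrime (chartAdjoin (K := K) x y) Q).toSubring)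
    (hdom : SubringDominates R O.toSubring)
    (hrich : ∀ (N : Type) [CommRing N] (ψ : R →+* N) (δ₀ : R →+ N),
      (∀ a b, δ₀ (a * b) = ψ a * δ₀ b + ψ b * δ₀ a) → ∀ Y : Finset R,
      ∃ (m : ℕ) (Δ : Fin m → Derivation ℤ R R) (nn : Fin m → N),
        ∀ y ∈ Y, δ₀ y = Finset.univ.sum fun j => ψ (Δ j y) * nn j)
    (hdual : ∀ (v : Fin 2 → R), Ideal.span (Set.range v) = maximalIdeal R →
      ∃ D : Fin 2 → Derivation ℤ R R, ∀ i j, D i (v j) = if i = j then 1 else 0)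
    (hmin : ∀ z ∈ maximalIdeal R, O.valuation (z : K) ≤ O.valuation ((x : R) : K))
    (hadapt : (⟨((y : R) : K) / ((x : R) : K), Algebra.subset_adjoin (Set.mem_singleton _)⟩ :
        chartAdjoin (K := K) x y) ∈ Q ∨ ∀ γ : R,
      (⟨((y : R) : K) / ((x : R) : K), Algebra.subset_adjoin (Set.mem_singleton _)⟩ :
        chartAdjoin (K := K) x y) - chartIncl x y γ ∉ Q)
    (f : R) (a : ℕ) (D₀ : Ideal R)
    (hC : Ideal.span {b | ∃ δ : Derivation ℤ R R, δ x ∈ Ideal.span {x} ∧ δ f = b} =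
      Ideal.span {x ^ a} * D₀)
    (hfin : IsFiniteLength R (R ⧸ D₀)) (htop : D₀ ≠ ⊤) :
    ∃ (w : (LocalSubring.ofPrime (chartAdjoin (K := K) x y) Q).toSubring) (a₁ : ℕ)
      (D₀' : Ideal (LocalSubring.ofPrime (chartAdjoin (K := K) x y) Q).toSubring),
      maximalIdeal (LocalSubring.ofPrime (chartAdjoin (K := K) x y) Q).toSubring =
        Ideal.span {Subring.inclusion h.le x, w} ∧
      Ideal.span {b | ∃ δ' : Derivation ℤ
          (LocalSubring.ofPrime (chartAdjoin (K := K) x y) Q).toSubring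
          (LocalSubring.ofPrime (chartAdjoin (K := K) x y) Q).toSubring,
        δ' (Subring.inclusion h.le x) ∈ Ideal.span {Subring.inclusion h.le x} ∧
          δ' (Subring.inclusion h.le f) = b} =
        Ideal.span {Subring.inclusion h.le x ^ a₁} * D₀' ∧
      IsFiniteLength (LocalSubring.ofPrime (chartAdjoin (K := K) x y) Q).toSubring
        ((LocalSubring.ofPrime (chartAdjoin (K := K) x y) Q).toSubring ⧸ D₀') ∧
      Module.length (LocalSubring.ofPrime (chartAdjoin (K := K) x y) Q).toSubring
        ((LocalSubring.ofPrime (chartAdjoin (K := K) x y) Q).toSubring ⧸ D₀') <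
        Module.length R (R ⧸ D₀) := by
  set T : Subring K := (LocalSubring.ofPrime (chartAdjoin (K := K) x y) Q).toSubring
  set aT : chartAdjoin (K := K) x y →+* T := algebraMap (chartAdjoin (K := K) x y) T
  have hcomp : Subring.inclusion h.le = aT.comp (chartIncl x y) :=
    RingHom.ext fun _ => Subtype.ext rfl
  -- the dual derivations of `(x, y)`
  have hv : Ideal.span (Set.range ![x, y]) = maximalIdeal R := by
    rw [Matrix.range_cons_cons_empty, hm]
  obtain ⟨D, hD⟩ := hdual _ hv
  have hDyx : D 1 x = 0 := by simpa using hD 1 0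
  have hDyy : D 1 y = 1 := by simpa using hD 1 1
  -- the finite parts `D₁ ⊆ D₀ = D₁ + (B)`
  obtain ⟨D₁, B, h10, hy0, hD0, hCxy⟩ := exists_finitePart_freeStep hx0 (D 1) hDyx hDyy f a D₀ hC
  -- F1: the content of `φ f` along `x` in `T`
  have hF1 := content_free_chart O R T h hdim hdom hrich ![x, y] D hD hv 0 hmin
    ![Subring.inclusion h.le x,
      aT ⟨((y : R) : K) / ((x : R) : K), Algebra.subset_adjoin (Set.mem_singleton _)⟩] rfl
    (fun j hj => by
      obtain rfl : j = 1 := Fin.eq_one_of_ne_zero j hj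
      rfl) f
  simp only [Finset.mem_singleton, forall_eq, Finset.mem_univ, true_implies, Fin.forall_fin_two,
    Matrix.cons_val_zero, Matrix.cons_val_one] at hF1
  rw [hCxy, hC] at hF1
  -- F2x: the colength of the finite part at `Q`
  obtain ⟨r, H', hfact, hfinH, -, hor⟩ :=
    free_chart_colength hdim hm hx0 D₁ D₀ B h10 hy0 hD0 hfin htop Q hxQ
  rw [← hcomp] at hfact
  have hlt := hor.resolve_right
    (not_bad_freeStep hdim hm hx0 (D 1) hDyx hDyy f a D₀ D₁ hC hCxy htop h10 Q hxQ hadapt)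
  -- `Q = (x, p)`, `𝔪_T = (x, p) T`
  obtain ⟨p, hQp⟩ := exists_eq_span_pair_of_map_maximalIdeal_le hm hx0 rfl (Q := Q)
    (by rw [map_maximalIdeal_chartIncl hm hx0, Ideal.span_singleton_le_iff_mem]; exact hxQ)
  have hmax : maximalIdeal T = Ideal.span {Subring.inclusion h.le x, aT p} := by
    have e : Q.map aT = (Ideal.span {chartIncl x y x, p}).map aT := congrArg (Ideal.map aT) hQp
    rw [← IsLocalization.AtPrime.map_eq_maximalIdeal Q T, e, Ideal.map_span, Set.image_pair,
      hcomp, RingHom.comp_apply]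
  refine ⟨aT p, a + r, H', hmax, ?_, hfinH, hlt⟩
  rw [hF1, pow_add, ← Ideal.span_singleton_mul_span_singleton, mul_assoc, ← hfact]
  simp only [Ideal.map_sup, Ideal.map_mul, Ideal.map_span, Set.image_singleton, map_pow,
    Ideal.mul_sup]
  rw [mul_left_comm]

end Chart

/-- **Registered stub `giraud_free_step_free`** (FS-F: Giraud 1983, Lemme 2.3 (ii)+(iii) in
valuation language — the FREE STEP with FREE successor). At the `{x}`-boundary state
`C_{x}(f; R) = (xᵃ) · D₀` (`x = u i₀` of minimal value, `D₀ ≠ R` of finite colength) of the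
two-dimensional regular local ring `R ⊆ K` dominated by `O`, the quadratic transform `R₁` along
`O` carries the `{x}`-boundary state `C_{x}(f; R₁) = (xᵃ¹) · D₀'` with respect to a regular
system of parameters `(x, w)` of `R₁`, with `λ(R₁/D₀') < λ(R/D₀)`. Proof: choose the second
parameter `y` adapted to the centre `Q` of `O` on the chart `R[y/x]` (`ν(y/x) > 0` if some
parameter allows it, otherwise no `ν(y/x - γ) > 0`), identify `R₁ = (R[y/x])_Q`
(`eq_locAtCentre_blowupRing_cornerStep`), and apply `free_step_chart_freeStep`. [folklore] -/
theorem giraud_free_step_free : ∀ {K : Type} [Field K] (O : ValuationSubring K) (R R₁ : Subring K) [IsRegularLocalRing R] [IsLocalRing R₁] (h : Literature.AlgebraicGeometry.Resolution.IsQuadraticTransformAlong O R R₁), ringKrullDim R = 2 → Literature.AlgebraicGeometry.Resolution.SubringDominates R O.toSubring → (∀ (N : Type) [CommRing N] (ψ : R →+* N) (δ₀ : R →+ N), (∀ a b, δ₀ (a * b) = ψ a * δ₀ b + ψ b * δ₀ a) → ∀ Y : Finset R, ∃ (m : ℕ) (Δ : Fin m → Derivation ℤ R R) (nn : Fin m →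 N), ∀ y ∈ Y, δ₀ y = Finset.univ.sum fun j => ψ (Δ j y) * nn j) → (∀ (v : Fin 2 → R), Ideal.span (Set.range v) = maximalIdeal R → ∃ D : Fin 2 → Derivation ℤ R R, ∀ i j, D i (v j) = if i = j then 1 else 0) → ∀ (u : Fin 2 → R), Ideal.span (Set.range u) = maximalIdeal R → ∀ (i₀ : Fin 2), (∀ z ∈ maximalIdeal R, O.valuation (z : K) ≤ O.valuation ((u i₀ : R) : K)) → ∀ (f : R) (a : ℕ) (D₀ : Ideal R), Ideal.span {b | ∃ δ : Derivation ℤ R R, (∀ i ∈ ({i₀} : Finset (Fin 2)), δ (u i) ∈ Ideal.span {u i}) ∧ δ f = b} = Ideal.span {u i₀ ^ a} * D₀ → IsFiniteLength R (R ⧸ D₀) → D₀ ≠ ⊤ → ringKrullDim R₁ ≤ 1 ∨ ∃ (u₁ : Fin 2 → R₁) (a₁ : ℕ) (D₀' : Ideal R₁), ((u₁ 0 : R₁) : K) = ((u i₀ : R) : K) ∧ Ideal.span (Set.range u₁) = maximalIdeal R₁ ∧ Ideal.span {b | ∃ δ' : Derivation ℤ R₁ R₁, (∀ i ∈ ({0}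 : Finset (Fin 2)), δ' (u₁ i) ∈ Ideal.span {u₁ i}) ∧ δ' (Subring.inclusion h.le f) = b} = Ideal.span {u₁ 0 ^ a₁} * D₀' ∧ IsFiniteLength R₁ (R₁ ⧸ D₀') ∧ Module.length R₁ (R₁ ⧸ D₀') < Module.length R (R ⧸ D₀) := by
  intro K _ O R R₁ _ _ h hdim hdom hrich hdual u hspan i₀ hmin f a D₀ hC hfin htop
  classical
  have hum : ∀ j, u j ∈ maximalIdeal R := fun j =>
    hspan ▸ Ideal.subset_span (Set.mem_range_self j)
  have hRO : R ≤ O.toSubring := hdom.1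
  have hx0 : u i₀ ≠ 0 := ne_zero_of_minimal_value_cornerStep O hdim hmin
  have hx0K : ((u i₀ : R) : K) ≠ 0 := fun e => hx0 (Subtype.ext e)
  have hval : ∀ z : R, z ∈ maximalIdeal R ↔ O.valuation (z : K) < 1 :=
    (subringDominates_valuationSubring_iff hRO).mp hdom
  -- `𝔪 = (x, u (i₀ + 1))`
  have hrange : Set.range u = {u i₀, u (i₀ + 1)} := by
    ext z
    simp only [Set.mem_range, Set.mem_insert_iff, Set.mem_singleton_iff]
    constructor
    · rintro ⟨j, rfl⟩
      rcases fin_two_eq_or_eq_add_one_cornerStep i₀ j with rfl | rfl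
      · exact Or.inl rfl
      · exact Or.inr rfl
    · rintro (rfl | rfl)
      exacts [⟨i₀, rfl⟩, ⟨i₀ + 1, rfl⟩]
  have hm₀ : maximalIdeal R = Ideal.span {u i₀, u (i₀ + 1)} := by rw [← hspan, hrange]
  -- the adapted second parameter `y`
  obtain ⟨y, hm, hadapt⟩ : ∃ y : R, maximalIdeal R = Ideal.span {u i₀, y} ∧
      (O.valuation (((y : R) : K) / ((u i₀ : R) : K)) < 1 ∨
        ∀ γ : R, ¬ O.valuation (((y : R) : K) / ((u i₀ : R) : K) - ((γ : R) : K)) < 1) := by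
    by_cases hrat : ∃ y : R, maximalIdeal R = Ideal.span {u i₀, y} ∧
        O.valuation (((y : R) : K) / ((u i₀ : R) : K)) < 1
    · obtain ⟨y, hm, hy⟩ := hrat
      exact ⟨y, hm, Or.inl hy⟩
    · refine ⟨u (i₀ + 1), hm₀, Or.inr fun γ hγ => hrat ⟨u (i₀ + 1) - γ * u i₀, ?_, ?_⟩⟩
      · rw [hm₀, Ideal.span_pair_sub_mul_left]
      · have e : (((u (i₀ + 1) - γ * u i₀ : R) : R) : K) / ((u i₀ : R) : K) =
            ((u (i₀ + 1) : R) : K) / ((u i₀ : R) : K) - ((γ : R) : K) := by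
          push_cast
          rw [sub_div, mul_div_cancel_right₀ _ hx0K]
        rw [e]
        exact hγ
  have hym : y ∈ maximalIdeal R := hm ▸ Ideal.subset_span (by simp)
  -- the chart `A = R[y/x] ⊆ O` and `R₁ = A_Q`, `Q` the centre of `O`
  have hyxO : ((y : R) : K) / ((u i₀ : R) : K) ∈ O.toSubring := by
    change ((y : R) : K) / ((u i₀ : R) : K) ∈ O
    rw [← O.valuation_le_one_iff, map_div₀,
      div_le_one₀ (pos_iff_ne_zero.mpr ((map_ne_zero _).mpr hx0K))]
    exact hmin _ hym
  have hAO : chartAdjoin (K := K) (u i₀) y ≤ O.toSubring := adjoin_toSubring_le hRO hyxO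
  have hA : blowupRing R ((u i₀ : R) : K) = chartAdjoin (K := K) (u i₀) y :=
    blowupRing_eq_adjoin hm
  have hR₁T : R₁ = (LocalSubring.ofPrime (chartAdjoin (K := K) (u i₀) y)
      (subringCentre (chartAdjoin (K := K) (u i₀) y) O hAO)).toSubring := by
    rw [eq_locAtCentre_blowupRing_cornerStep O R R₁ h hRO u hspan i₀ hx0 hmin, hA]
    exact locAtCentre_eq_ofPrime hAO
  subst hR₁T
  have hxQ : chartIncl (u i₀) y (u i₀) ∈ subringCentre (chartAdjoin (K := K) (u i₀) y) O hAO :=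
    (mem_subringCentre_iff hAO _).mpr ((hval _).mp (hum i₀))
  have hadapt' : (⟨((y : R) : K) / ((u i₀ : R) : K), Algebra.subset_adjoin (Set.mem_singleton _)⟩ :
        chartAdjoin (K := K) (u i₀) y) ∈ subringCentre (chartAdjoin (K := K) (u i₀) y) O hAO ∨
      ∀ γ : R, (⟨((y : R) : K) / ((u i₀ : R) : K), Algebra.subset_adjoin (Set.mem_singleton _)⟩ :
        chartAdjoin (K := K) (u i₀) y) - chartIncl (u i₀) y γ ∉
          subringCentre (chartAdjoin (K := K) (u i₀) y) O hAO := by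
    rcases hadapt with hlt | hnr
    · exact Or.inl ((mem_subringCentre_iff hAO _).mpr hlt)
    · exact Or.inr fun γ hγ => hnr γ ((mem_subringCentre_iff hAO _).mp hγ)
  have hC' : Ideal.span {b | ∃ δ : Derivation ℤ R R, δ (u i₀) ∈ Ideal.span {u i₀} ∧ δ f = b} =
      Ideal.span {u i₀ ^ a} * D₀ := by
    simpa only [Finset.mem_singleton, forall_eq] using hC
  obtain ⟨w, a₁, D₀', hmax, hcont, hfin', hlt⟩ := free_step_chart_freeStep O R hdim hm hx0 _ hxQ
    h hdom hrich hdual hmin hadapt' f a D₀ hC' hfin htop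
  refine Or.inr ⟨![Subring.inclusion h.le (u i₀), w], a₁, D₀', rfl, ?_, ?_, hfin', hlt⟩
  · rw [Matrix.range_cons_cons_empty, hmax]
  · simpa only [Finset.mem_singleton, forall_eq, Matrix.cons_val_zero] using hcont

end Summit.ResolutionOfSingularities.ResolutionOfSingularities.Theorems.PfaffLine

end
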